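import Summits.MatrixMultiplication.OmegaCensus.C2C2QuaternionTwoPowLaw
import Summits.MatrixMultiplication.OmegaCensus.C2CubeQuaternionLaw
import Summits.MatrixMultiplication.OmegaCensus.C2C2SemidirectZ4Law
import Summits.MatrixMultiplication.OmegaCensus.DicyclicLawModOne
import Summits.MatrixMultiplication.OmegaCensus.DihedralLikeLawGap12
import Mathlib.GroupTheory.SpecificGroups.Quaternion
import HarnessLib

/-!
# `C₂³ × Q_{4m}` (`m = 2^k`) and `C₂² × (ℤ_n ⋊ ℤ₄)` (`n = 2^k`): the dicyclic law is not attained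

ω-census `pub-omega`, family (b3), seat pub-omega-group gen 12.  Framing: lottery ticket; floor = certified bounds/negative
ranges.  VALUE: kernel census clauses (group-theoretic method); NOT progress on ω.

Instances of `no_dicyclic_law_of_two_group_quot` (`DicyclicLawTwoGroupQuotient.lean`):
* `C₂³ × Q_{4m} = G(ℤ₂³ × ℤ_{2m}, (0,0,0,m))`, `m = 2^k ≥ 4`: quotient `ℤ₂³ × ℤ_m` via `(id,id,id, mod m)`, characters the
  three `ℤ₂`-coordinates: `c2c2c2_quaternion_no_dicyclic_law_two_pow` (**`3V + 16 ≠ 128m`**) and, for `m ≡ 2 (mod 3)`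
  (`m = 8, 32, …`), `c2c2c2_quaternion_two_pow_le` (**`3V + 28 ≤ 128m`**, i.e. `β ≤ (128m − 28)/3`; before: `(128m−16)/3`).
* `C₂² × (ℤ_n ⋊ ℤ₄) = G(ℤ₂² × ℤ₂ × ℤ_n, (0,0,1,0))`, `n = 2^k ≥ 8`: quotient `ℤ₂² × ℤ_n` via `(x,y,ε,z) ↦ (x,y,z)`,
  characters `x`, `y`, `z mod 2`: `c2c2_semidirect_no_dicyclic_law_two_pow` (**`3V + 16 ≠ 64n`**) and, for `n ≡ 1 (mod 3)`
  (`n = 16, 64, …`), `c2c2_semidirect_two_pow_le` (**`3V + 28 ≤ 64n`**).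
(`C₂² × Q_{4m}`: `C2C2QuaternionTwoPowLaw.lean`.)
-/

namespace Summit.MatrixMultiplication.OmegaCensus

open Literature.Combinatorics.Additive Finset

section C2CubeQ

variable {m : ℕ} [NeZero m]

/-- **`C₂³ × Q_{4m}`, `m = 2^k` (`k ≥ 2`): no TPP triple attains `3|S||T||U| + 16 = 128m`.** [folklore] -/
theorem c2c2c2_quaternion_no_dicyclic_law_two_pow (k : ℕ) (hk : 2 ≤ k) (hm : m = 2 ^ k)
    {S T U : Finset (Multiplicative (ZMod 2) × (Multiplicative (ZMod 2) × (Multiplicative (ZMod 2) × QuaternionGroup m)))}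
    (h : TripleProductProperty S T U) : 3 * (S.card * T.card * U.card) + 16 ≠ 128 * m := by
  have hm4 : 4 ≤ m := by
    rw [hm]; calc 4 = 2 ^ 2 := by norm_num
      _ ≤ 2 ^ k := Nat.pow_le_pow_right (by norm_num) hk
  haveI : NeZero (2 * m) := ⟨by omega⟩
  obtain ⟨hc₀'', -⟩ := z2_z2_z2_z2m_quot_noncyclic (m := m)
  refine c2_quaternion_presentation (m := m) fun ρ τ c₀ hρρ hρτ hτρ hττ hρ hτ hne hsurj hc => ?_
  subst hc
  refine c2_product_presentation hρρ hρτ hτρ hττ hρ hτ hne hsurj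
    fun ρ' τ' c₀' hρρ' hρτ' hτρ' hττ' hρ' hτ' hne' hsurj' hc' => ?_
  subst hc'
  refine c2_product_presentation hρρ' hρτ' hτρ' hττ' hρ' hτ' hne' hsurj'
    fun ρ'' τ'' c₀'' hρρ'' hρτ'' hτρ'' hττ'' hρ'' hτ'' hne'' hsurj'' hc'' => ?_
  subst hc''
  have hcard : Fintype.card (ZMod 2 × (ZMod 2 × (ZMod 2 × ZMod (2 * m)))) = 16 * m := by
    rw [Fintype.card_prod, Fintype.card_prod, Fintype.card_prod, ZMod.card, ZMod.card]; ring
  -- the three `ℤ₂`-coordinates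
  let A' := ZMod 2 × (ZMod 2 × (ZMod 2 × ZMod (2 * m)))
  let ψ₁ : A' →+ ZMod 2 := AddMonoidHom.fst _ _
  let ψ₂ : A' →+ ZMod 2 := (AddMonoidHom.fst _ _).comp (AddMonoidHom.snd _ _)
  let ψ₃ : A' →+ ZMod 2 := (AddMonoidHom.fst _ _).comp ((AddMonoidHom.snd _ _).comp (AddMonoidHom.snd _ _))
  have hψc : ψ₁ (0, (0, (0, (m : ZMod (2 * m))))) = 0 ∧ ψ₂ (0, (0, (0, (m : ZMod (2 * m))))) = 0 ∧
      ψ₃ (0, (0, (0, (m : ZMod (2 * m))))) = 0 := ⟨rfl, rfl, rfl⟩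
  have hψ : ∀ v : ZMod 2 × ZMod 2 × ZMod 2, ∃ x, (ψ₁ x, ψ₂ x, ψ₃ x) = v := by
    rintro ⟨v₁, v₂, v₃⟩; exact ⟨(v₁, (v₂, (v₃, 0))), rfl⟩
  -- the quotient map `(id, id, id, mod m)`
  let π : A' →+ ZMod 2 × (ZMod 2 × (ZMod 2 × ZMod m)) :=
    (AddMonoidHom.fst _ _).prod (((AddMonoidHom.fst _ _).comp (AddMonoidHom.snd _ _)).prod
      (((AddMonoidHom.fst _ _).comp ((AddMonoidHom.snd _ _).comp (AddMonoidHom.snd _ _))).prod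
        ((ZMod.castHom (dvd_mul_left m 2) (ZMod m)).toAddMonoidHom.comp
          ((AddMonoidHom.snd _ _).comp ((AddMonoidHom.snd _ _).comp (AddMonoidHom.snd _ _))))))
  have hπ : ∀ p : A', π p = (p.1, (p.2.1, (p.2.2.1, ZMod.castHom (dvd_mul_left m 2) (ZMod m) p.2.2.2))) :=
    fun p => rfl
  have hker : ∀ a, π a = 0 ↔ a = 0 ∨ a = (0, (0, (0, (m : ZMod (2 * m))))) := by
    intro a
    rw [hπ, Prod.mk_eq_zero, Prod.mk_eq_zero, Prod.mk_eq_zero, zmod_castHom_two_mul_eq_zero_iff]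
    constructor
    · rintro ⟨h1, h2, h3, h4 | h4⟩
      · left; exact Prod.ext h1 (Prod.ext h2 (Prod.ext h3 h4))
      · right; exact Prod.ext h1 (Prod.ext h2 (Prod.ext h3 h4))
    · rintro (rfl | rfl)
      · exact ⟨rfl, rfl, rfl, Or.inl rfl⟩
      · exact ⟨rfl, rfl, rfl, Or.inr rfl⟩
  have hπs : Function.Surjective π := by
    rintro ⟨x, y, e, w⟩
    refine ⟨(x, (y, (e, ((w.val : ℕ) : ZMod (2 * m))))), ?_⟩
    rw [hπ]
    simp only
    rw [map_natCast, ZMod.natCast_zmod_val]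
  have hB : ∀ b : ZMod 2 × (ZMod 2 × (ZMod 2 × ZMod m)), (2 ^ k) • b = 0 := by
    rintro ⟨x, y, e, w⟩
    have h2 : ((2 ^ k : ℕ) : ZMod 2) = 0 :=
      (ZMod.natCast_eq_zero_iff _ 2).2 ⟨2 ^ (k - 1), by rw [← pow_succ']; congr 1; omega⟩
    have hw : ((2 ^ k : ℕ) : ZMod m) = 0 := by rw [← hm]; exact ZMod.natCast_self m
    refine Prod.ext ?_ (Prod.ext ?_ (Prod.ext ?_ ?_))
    · show (2 ^ k) • x = 0; rw [nsmul_eq_mul, h2, zero_mul]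
    · show (2 ^ k) • y = 0; rw [nsmul_eq_mul, h2, zero_mul]
    · show (2 ^ k) • e = 0; rw [nsmul_eq_mul, h2, zero_mul]
    · show (2 ^ k) • w = 0; rw [nsmul_eq_mul, hw, zero_mul]
  have key := no_dicyclic_law_of_two_group_quot hρρ'' hρτ'' hτρ'' hττ'' hc₀'' hρ'' hτ'' hne'' hsurj''
    (by rw [hcard]; omega) ψ₁ ψ₂ ψ₃ hψc hψ π hπs hker hB h
  rwa [hcard, show 8 * (16 * m) = 128 * m by ring] at key

/-- **`β(C₂³ × Q_{4m}) ≤ (128m − 28)/3` for `m = 2^k ≡ 2 (mod 3)`** (`m = 8, 32, 128, …`): `3|S||T||U| + 28 ≤ 128m` for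
every TPP triple. [folklore] -/
theorem c2c2c2_quaternion_two_pow_le (k : ℕ) (hk : 2 ≤ k) (hm : m = 2 ^ k) (h2 : m % 3 = 2)
    {S T U : Finset (Multiplicative (ZMod 2) × (Multiplicative (ZMod 2) × (Multiplicative (ZMod 2) × QuaternionGroup m)))}
    (h : TripleProductProperty S T U) : 3 * (S.card * T.card * U.card) + 28 ≤ 128 * m := by
  have hm4 : 4 ≤ m := by
    rw [hm]; calc 4 = 2 ^ 2 := by norm_num
      _ ≤ 2 ^ k := Nat.pow_le_pow_right (by norm_num) hk
  haveI : NeZero (2 * m) := ⟨by omega⟩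
  have hne16 := c2c2c2_quaternion_no_dicyclic_law_two_pow k hk hm h
  obtain ⟨hc₀'', -⟩ := z2_z2_z2_z2m_quot_noncyclic (m := m)
  have hgap : 3 * (S.card * T.card * U.card) + 16 ≤ 8 * (16 * m) ∧
      (3 * (S.card * T.card * U.card) + 4 = 8 * (16 * m) ∨ 3 * (S.card * T.card * U.card) + 16 = 8 * (16 * m) ∨
      3 * (S.card * T.card * U.card) + 28 = 8 * (16 * m) ∨ 3 * (S.card * T.card * U.card) + 32 ≤ 8 * (16 * m)) := by
    refine c2_quaternion_presentation (m := m) fun ρ τ c₀ hρρ hρτ hτρ hττ hρ hτ hne hsurj hc => ?_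
    subst hc
    refine c2_product_presentation hρρ hρτ hτρ hττ hρ hτ hne hsurj
      fun ρ' τ' c₀' hρρ' hρτ' hτρ' hττ' hρ' hτ' hne' hsurj' hc' => ?_
    subst hc'
    refine c2_product_presentation hρρ' hρτ' hτρ' hττ' hρ' hτ' hne' hsurj'
      fun ρ'' τ'' c₀'' hρρ'' hρτ'' hτρ'' hττ'' hρ'' hτ'' hne'' hsurj'' hc'' => ?_
    subst hc''
    have hcard : Fintype.card (ZMod 2 × (ZMod 2 × (ZMod 2 × ZMod (2 * m)))) = 16 * m := by
      rw [Fintype.card_prod, Fintype.card_prod, Fintype.card_prod, ZMod.card, ZMod.card]; ring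
    have h16 := tpp_volume_le_law_dicyclicLike hρρ'' hρτ'' hτρ'' hττ'' hρ'' hτ'' hne'' hsurj''
      (two_c0_eq_zero hρτ'' hτρ'' hττ'' hτ'') hc₀'' (by rw [hcard]; omega) (by rw [hcard]; omega) h
    have key := tpp_volume_mod_two_gap12 hρρ'' hρτ'' hτρ'' hττ'' hρ'' hτ'' hne'' hsurj'' (by rw [hcard]; omega)
      (by rw [hcard]; omega) h
    rw [hcard] at h16 key
    exact ⟨h16, key⟩
  omega

end C2CubeQ

section C2C2Semidirect

variable {n : ℕ} [NeZero n]

/-- **`C₂² × (ℤ_n ⋊ ℤ₄)`, `n = 2^k` (`k ≥ 3`): no TPP triple attains `3|S||T||U| + 16 = 64n`.** [folklore] -/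
theorem c2c2_semidirect_no_dicyclic_law_two_pow (k : ℕ) (hk : 3 ≤ k) (hn : n = 2 ^ k)
    {S T U : Finset (Multiplicative (ZMod 2) ×
      (Multiplicative (ZMod 2) × DihedralLikeGroup (ZMod 2 × ZMod n) ((1 : ZMod 2), 0)))}
    (h : TripleProductProperty S T U) : 3 * (S.card * T.card * U.card) + 16 ≠ 64 * n := by
  have hn8 : 8 ≤ n := by
    rw [hn]; calc 8 = 2 ^ 3 := by norm_num
      _ ≤ 2 ^ k := Nat.pow_le_pow_right (by norm_num) hk
  obtain ⟨hc₀', -⟩ := z2_z2_z2_zn_quot_noncyclic (n := n)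
  refine c2_semidirect_presentation (n := n) fun ρ τ c₀ hρρ hρτ hτρ hττ hρ hτ hne hsurj hc => ?_
  subst hc
  refine c2_product_presentation hρρ hρτ hτρ hττ hρ hτ hne hsurj
    fun ρ' τ' c₀' hρρ' hρτ' hτρ' hττ' hρ' hτ' hne' hsurj' hc' => ?_
  subst hc'
  have hcard : Fintype.card (ZMod 2 × (ZMod 2 × (ZMod 2 × ZMod n))) = 8 * n := by
    rw [Fintype.card_prod, Fintype.card_prod, Fintype.card_prod, ZMod.card, ZMod.card]; ring
  have h2n : 2 ∣ n := ⟨2 ^ (k - 1), by rw [hn, ← pow_succ']; congr 1; omega⟩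
  let A' := ZMod 2 × (ZMod 2 × (ZMod 2 × ZMod n))
  -- characters `x`, `y`, `z mod 2`
  let ψ₁ : A' →+ ZMod 2 := AddMonoidHom.fst _ _
  let ψ₂ : A' →+ ZMod 2 := (AddMonoidHom.fst _ _).comp (AddMonoidHom.snd _ _)
  let ψ₃ : A' →+ ZMod 2 := (ZMod.castHom h2n (ZMod 2)).toAddMonoidHom.comp
    ((AddMonoidHom.snd _ _).comp ((AddMonoidHom.snd _ _).comp (AddMonoidHom.snd _ _)))
  have hψ₃ : ∀ p : A', ψ₃ p = ZMod.castHom h2n (ZMod 2) p.2.2.2 := fun p => rfl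
  have hψc : ψ₁ (0, (0, (1, (0 : ZMod n)))) = 0 ∧ ψ₂ (0, (0, (1, (0 : ZMod n)))) = 0 ∧
      ψ₃ (0, (0, (1, (0 : ZMod n)))) = 0 := by
    refine ⟨rfl, rfl, ?_⟩
    rw [hψ₃]; exact map_zero _
  have hψ : ∀ v : ZMod 2 × ZMod 2 × ZMod 2, ∃ x, (ψ₁ x, ψ₂ x, ψ₃ x) = v := by
    rintro ⟨v₁, v₂, v₃⟩
    refine ⟨(v₁, (v₂, (0, ((v₃.val : ℕ) : ZMod n)))), ?_⟩
    simp only [Prod.mk.injEq]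
    refine ⟨rfl, rfl, ?_⟩
    rw [hψ₃]
    show ZMod.castHom _ (ZMod 2) ((v₃.val : ℕ) : ZMod n) = v₃
    rw [map_natCast, ZMod.natCast_zmod_val]
  -- the quotient map `(x, y, ε, z) ↦ (x, y, z)`
  let π : A' →+ ZMod 2 × (ZMod 2 × ZMod n) :=
    (AddMonoidHom.fst _ _).prod (((AddMonoidHom.fst _ _).comp (AddMonoidHom.snd _ _)).prod
      ((AddMonoidHom.snd _ _).comp ((AddMonoidHom.snd _ _).comp (AddMonoidHom.snd _ _))))
  have hπ : ∀ p : A', π p = (p.1, (p.2.1, p.2.2.2)) := fun p => rfl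
  have he2 : ∀ e : ZMod 2, e = 0 ∨ e = 1 := by decide
  have hker : ∀ a, π a = 0 ↔ a = 0 ∨ a = (0, (0, (1, (0 : ZMod n)))) := by
    rintro ⟨x, y, e, z⟩
    rw [hπ]
    constructor
    · intro h0
      have hx : x = 0 := congrArg Prod.fst h0
      have hy : y = 0 := congrArg (fun q : ZMod 2 × (ZMod 2 × ZMod n) => q.2.1) h0
      have hz : z = 0 := congrArg (fun q : ZMod 2 × (ZMod 2 × ZMod n) => q.2.2) h0
      subst hx; subst hy; subst hz
      rcases he2 e with rfl | rfl
      · exact Or.inl rfl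
      · exact Or.inr rfl
    · rintro (h0 | h0)
      · have hx : x = 0 := congrArg Prod.fst h0
        have hy : y = 0 := congrArg (fun q : ZMod 2 × (ZMod 2 × (ZMod 2 × ZMod n)) => q.2.1) h0
        have hz : z = 0 := congrArg (fun q : ZMod 2 × (ZMod 2 × (ZMod 2 × ZMod n)) => q.2.2.2) h0
        subst hx; subst hy; subst hz; rfl
      · have hx : x = 0 := congrArg Prod.fst h0
        have hy : y = 0 := congrArg (fun q : ZMod 2 × (ZMod 2 × (ZMod 2 × ZMod n)) => q.2.1) h0
        have hz : z = 0 := congrArg (fun q : ZMod 2 × (ZMod 2 × (ZMod 2 × ZMod n)) => q.2.2.2) h0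
        subst hx; subst hy; subst hz; rfl
  have hπs : Function.Surjective π := by
    rintro ⟨x, y, z⟩; exact ⟨(x, (y, (0, z))), rfl⟩
  have hB : ∀ b : ZMod 2 × (ZMod 2 × ZMod n), (2 ^ k) • b = 0 := by
    rintro ⟨x, y, w⟩
    have h2 : ((2 ^ k : ℕ) : ZMod 2) = 0 :=
      (ZMod.natCast_eq_zero_iff _ 2).2 ⟨2 ^ (k - 1), by rw [← pow_succ']; congr 1; omega⟩
    have hw : ((2 ^ k : ℕ) : ZMod n) = 0 := by rw [← hn]; exact ZMod.natCast_self n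
    refine Prod.ext ?_ (Prod.ext ?_ ?_)
    · show (2 ^ k) • x = 0; rw [nsmul_eq_mul, h2, zero_mul]
    · show (2 ^ k) • y = 0; rw [nsmul_eq_mul, h2, zero_mul]
    · show (2 ^ k) • w = 0; rw [nsmul_eq_mul, hw, zero_mul]
  have key := no_dicyclic_law_of_two_group_quot hρρ' hρτ' hτρ' hττ' hc₀' hρ' hτ' hne' hsurj'
    (by rw [hcard]; omega) ψ₁ ψ₂ ψ₃ hψc hψ π hπs hker hB h
  rwa [hcard, show 8 * (8 * n) = 64 * n by ring] at key

/-- **`β(C₂² × (ℤ_n ⋊ ℤ₄)) ≤ (64n − 28)/3` for `n = 2^k ≡ 1 (mod 3)`** (`n = 16, 64, …`): `3|S||T||U| + 28 ≤ 64n` for every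
TPP triple. [folklore] -/
theorem c2c2_semidirect_two_pow_le (k : ℕ) (hk : 3 ≤ k) (hn : n = 2 ^ k) (h1 : n % 3 = 1)
    {S T U : Finset (Multiplicative (ZMod 2) ×
      (Multiplicative (ZMod 2) × DihedralLikeGroup (ZMod 2 × ZMod n) ((1 : ZMod 2), 0)))}
    (h : TripleProductProperty S T U) : 3 * (S.card * T.card * U.card) + 28 ≤ 64 * n := by
  have hn8 : 8 ≤ n := by
    rw [hn]; calc 8 = 2 ^ 3 := by norm_num
      _ ≤ 2 ^ k := Nat.pow_le_pow_right (by norm_num) hk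
  have hne16 := c2c2_semidirect_no_dicyclic_law_two_pow k hk hn h
  obtain ⟨hc₀', -⟩ := z2_z2_z2_zn_quot_noncyclic (n := n)
  have hgap : 3 * (S.card * T.card * U.card) + 16 ≤ 8 * (8 * n) ∧
      (3 * (S.card * T.card * U.card) + 4 = 8 * (8 * n) ∨ 3 * (S.card * T.card * U.card) + 16 = 8 * (8 * n) ∨
      3 * (S.card * T.card * U.card) + 28 = 8 * (8 * n) ∨ 3 * (S.card * T.card * U.card) + 32 ≤ 8 * (8 * n)) := by
    refine c2_semidirect_presentation (n := n) fun ρ τ c₀ hρρ hρτ hτρ hττ hρ hτ hne hsurj hc => ?_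
    subst hc
    refine c2_product_presentation hρρ hρτ hτρ hττ hρ hτ hne hsurj
      fun ρ' τ' c₀' hρρ' hρτ' hτρ' hττ' hρ' hτ' hne' hsurj' hc' => ?_
    subst hc'
    have hcard : Fintype.card (ZMod 2 × (ZMod 2 × (ZMod 2 × ZMod n))) = 8 * n := by
      rw [Fintype.card_prod, Fintype.card_prod, Fintype.card_prod, ZMod.card, ZMod.card]; ring
    have h16 := tpp_volume_le_law_dicyclicLike hρρ' hρτ' hτρ' hττ' hρ' hτ' hne' hsurj'
      (two_c0_eq_zero hρτ' hτρ' hττ' hτ') hc₀' (by rw [hcard]; omega) (by rw [hcard]; omega) h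
    have key := tpp_volume_mod_two_gap12 hρρ' hρτ' hτρ' hττ' hρ' hτ' hne' hsurj' (by rw [hcard]; omega)
      (by rw [hcard]; omega) h
    rw [hcard] at h16 key
    exact ⟨h16, key⟩
  omega

end C2C2Semidirect

end Summit.MatrixMultiplication.OmegaCensus
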